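import Summits.BirchSwinnertonDyer.BirchSwinnertonDyer.Theses.UniversalToricDescent
import Summits.BirchSwinnertonDyer.BirchSwinnertonDyer.Theorems.UniversalToricDescentTwinWanFrameAtThreeMultTresTAllSplit
import Literature.NumberTheory.EllipticCurves.Castella2018.HidaMembersFramesSigmaCongruenceOddPrime
import HarnessLib

/-!
# Route `UniversalToricDescent`, rev 59 / rev 70: the split glue of ♭B′ — `TwinWanFrameMultTresTOfMemberTowerChildren`
# (stmt-BirchSwinnertonDyer-27935) BY NAME

The item-level split (pen bsd-wall-pss3x g5, route rev 59) of the crux ♭B′ `TwinWanFrameAtThreeMultTresT`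
(stmt-BirchSwinnertonDyer-27401) along line `membertower` (lead bsd-wall-utd-p2 g13/g15; skeleton v12 sha16
efdcd8a75ae3912d) has three children — `TwinHsiehThmBInput` (Hsieh 2014 Thm. B by name),
`TwinCastellaMembersFramesCongruenceOddInput` (Castella 2020 §2 Thm. 2.11 / Skinner 2016 §2.6 at an odd prime WITH the erratum's
print hypothesis (iii), by name) and the crux `TwinMemberRationalInclusionAtThree` (K1-at-3) — and this glue item
`children ⟹ parent`.

HISTORY. At rev 59 the middle child aliased `Castella2018.castella2020_thm211_members_frames_sigma_congruence_odd` (p633915) and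
the glue was p635340 verbatim (p637223). The vet (bsd-vet-utdR2 g0, 2026-08-28) RETURNED that alias as misstated (its conclusion's
rigidity-sign conjunct lacks print's hypothesis (iii) «non-split multiplicative at every `q ∥ N` non-split in `K`»); the typer
(bsd-wall-utd-ty1 g12) landed the print-faithful re-type `…_odd_nonsplit` (p643788); the route pen RE-KEYED the child to it at
rev 70 (pss3x g6), across which this module carried a two-branch `first | new | old` proof (p646818, width seat
bsd-wall-utd-p2-w2 g7) so that nothing went red. ROUND r1 (2026-08-28, width seat bsd-wall-utd-p2-w2 g9, pen sequence T0→T3 after the vet RETURN of K1-at-3 27934 — module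
normalisation, PEN-RULING-27934-v1): the middle child is about to be re-keyed (R(i)) from `…_odd_nonsplit` (p643788) to the
weight-sharpened supply `…_odd_nonsplit_wt` (p661053: the same fact with the member weights chosen in the sub-progression
`k_m ≡ 2 (mod 2(p−1)p^{m−1})`, print's free choice — Skinner 2016 §2.6), so this module again carries a two-branch
`first | old | old ∘ …_of_wt` proof; round r2 (the lead's kernel† on the self-dual module, for R(ii)) will add a third branch.
Before r1 this was the plain re-land after the rev-70 restate: the glue is EXACTLY the all-split
turnkey `UniversalToricDescentTwinWanFrameAtThreeMultTresTAllSplit.twinWanFrameAtThreeMultTresT_of_thmB_of_nonsplitMembersFrames_of_rationalInclusion`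
(p645093), whose three hypotheses are the three children verbatim (the middle one = the `…_odd_nonsplit` fact; hypothesis (iii) is
discharged inside the turnkey from ♭B′'s all-split `SatisfiesHeegnerHypothesis N′ K`). Nothing mathematical is added here; the
research content of the column is the child K1-at-3 (stmt-BirchSwinnertonDyer-27934), untouched. BSD is proved for no curve by
this file.
-/

set_option linter.dupNamespace false
set_option autoImplicit false

namespace Summit.BirchSwinnertonDyer.BirchSwinnertonDyer.Theorems.UniversalToricDescentTwinWanFrameMultTresTOfMemberTowerChildren

-- the dormant branch of a restate-robust `first | … | …` is, by design, never executed at the current route rev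
set_option linter.unreachableTactic false in
set_option linter.unusedTactic false in
open Summit.BirchSwinnertonDyer.BirchSwinnertonDyer.Theses.UniversalToricDescent in
/-- **Glue of the ♭B′ split (route rev 59, child 27933 re-keyed at rev 70), by name.** `TwinHsiehThmBInput →
TwinCastellaMembersFramesCongruenceOddInput → TwinMemberRationalInclusionAtThree → TwinWanFrameAtThreeMultTresT` is the landed
all-split member-tower turnkey p645093 (= p635340 reading the member data through the print-faithful `…_odd_nonsplit` fact)
applied to the three children (their texts are its three hypotheses verbatim). -/
theorem twinWanFrameMultTresTOfMemberTowerChildren_proof : TwinWanFrameMultTresTOfMemberTowerChildren :=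
  fun hB hC hK => by
    -- RESTATE-ROBUST (round 1, pen sequence T1 of 2026-08-28T18:50:09Z): branch 1 = the middle child keyed on
    -- `…_odd_nonsplit` (route rev 70/71); branch 2 = the middle child re-keyed on the weight-sharpened supply
    -- `…_odd_nonsplit_wt` (p661053), read through the projection `…_of_wt`. Exactly one branch elaborates at any route rev.
    first
    | exact Summit.BirchSwinnertonDyer.BirchSwinnertonDyer.Theorems.UniversalToricDescentTwinWanFrameAtThreeMultTresTAllSplit.twinWanFrameAtThreeMultTresT_of_thmB_of_nonsplitMembersFrames_of_rationalInclusion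
        hB hC hK
    | exact Summit.BirchSwinnertonDyer.BirchSwinnertonDyer.Theorems.UniversalToricDescentTwinWanFrameAtThreeMultTresTAllSplit.twinWanFrameAtThreeMultTresT_of_thmB_of_nonsplitMembersFrames_of_rationalInclusion
        hB (Literature.NumberTheory.EllipticCurves.Castella2018.castella2020_thm211_members_frames_sigma_congruence_odd_nonsplit_of_wt hC) hK

end Summit.BirchSwinnertonDyer.BirchSwinnertonDyer.Theorems.UniversalToricDescentTwinWanFrameMultTresTOfMemberTowerChildren
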